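import Summits.QuantumFields.BalabanUV.T4Continuum.Support.GradedWellSlice
import Summits.QuantumFields.BalabanUV.T4Continuum.Support.GradedSubBlockTents
import Summits.QuantumFields.BalabanUV.T4Continuum.Support.RegionScalarCompression

/-!
# T⁴ programme, spine node NE2 (U1a), sub-row Δ1 — THE GRADED WELL, crew socket (GW-K) part 1: THE GRAM MATRIX
# `K = Q′ₙ·G′_GW²·Q′ₙᴴ` OF THE GRADED SCALAR DATA IS COERCIVE WITH A LEVEL-FREE CONSTANT, `‖K⁻¹‖ ≤ σ_GW⁻²`

NE2 formalisation swarm, leaf-05 (gen 10), socket **(GW-K)** of the owner's RULING R48 (journal 2026-08-21) on the owner's files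
`GradedWellData` (O16-b: `QsGW`, `QsGWw`, `DpGW = −Δ + a′Q′_wᴴQ′_w`, `GOmGW = DpGW⁻¹`) and `GradedWellSlice` (O16-c: normalised rows
`QsGWn`, `QsGWn·QsGWnᴴ = 1`).  R48 asks for `IsUnit (KGW …).det` and `‖(KGW …)⁻¹‖ ≤ ki` with `ki` LEVEL-FREE, `KGW := gramK GOmGW QsGWn`
(O16-d; `gramK G Q = Q·G·G·Qᴴ`).  The generic `RegionGaugeProjection.opNorm_inv_gramK_le` gives `‖DpGW‖² ≍ n⁴`; the level-free
constant is [B8] (3.48)'s variational argument with ONE SMOOTH TENT PER ROW (file `GradedSubBlockTents`):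
 * §1 `beta1_le_one`, `lev_le_pow_mul_sGW` (`n ≤ L^m·s_i` for all `i ≤ m`), `sigGW d L m a′ = 6^{−2d}/((4d(m+1) + a′)L^{2m})`;
 * §2 the trial field `psiG c = Σ_i tentS s_i (coefG c i)` (amplitude `c_p·s_p^{−d/2}` on the sub-block of row `p`):
   **`QsGWn_psiG : Q′ₙψ_c = (β₁(s_p)^d c_p)_p`** (distinct rows have disjoint sub-blocks — O16-c `blockOf_eq_of_inSub`),
   `energy_psiG_le : Σ_ν‖∂_νψ_c‖² ≤ 4d(m+1)L^{2m}‖c‖²`, `nsq_QsGWw_psiG_le : ‖Q′_wψ_c‖² ≤ L^{2m}‖c‖²` (`w_p/√(s_p^d) = L^{i_p}`),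
   `re_form_DpGW`, `re_form_DpGW_psiG_le : Re⟨ψ_c, Δ′_GWψ_c⟩ ≤ (4d(m+1) + a′)L^{2m}‖c‖²`;
 * §3 **`form_SGW_ge : σ_GW‖c‖² ≤ Re⟨c, Q′ₙG′_GWQ′ₙᴴc⟩`** (`RegionScalarCompression.variational_abs`, `h = Q′ₙᴴc`, `g = t·ψ_c`),
   `nsq_mulVec_le_of_mul_conjTranspose_eq_one`, `nsq_SGW_le_form_gramK` (`K ≥ S²`), **`coercive_gramK_GW : Coercive K σ_GW²`**,
   **`isUnit_det_gramK_GW`**, **`opNorm_inv_gramK_GW_le : ‖K⁻¹‖ ≤ (σ_GW²)⁻¹`** — R48's `hK`/`hki`, `ki = σ_GW⁻²` depending on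
   `d, L, m, a′` only.  Hypotheses: `IsUnit (DpGW …).det` (O16-e) and `0 < a′`.

HONEST FRAMING (T4-DAG p. 1).  [folklore] finite-dimensional variational calculus at model level (`U = 1`, one layer map, `m` fixed,
finite torus); located SHAPE [B8] (3.48) for graded means, constants ours; (GW-K) part 2 (`‖K_{k+1}⁻¹ − K_k⁻¹‖ ≤ Ck·L^{−k}`) NOT here.
NE2 (U1a) NOT proved; spine PROVED 0/9; NOT [B9] (3.16)/(3.23)–(3.27) as printed; NOT infinite volume / mass gap / Clay.  HONEST
DEPENDENCY: continuum YM on T⁴ ⇐ BetaPertH ∧ nine spine estimates (0/9 proved); BetaPertH ⇐ (D1) ∧ (D4) ∧ CAP+tail.  No `sorry`.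
-/

noncomputable section

open scoped BigOperators ComplexConjugate Matrix Matrix.Norms.L2Operator
open Finset

namespace Summit.QuantumFields.BalabanUV.T4Continuum.GradedWellGram

open Literature.MathematicalPhysics.QuantumFieldTheory.Balaban1983to89.B5Prop11Plancherel (Tor fine unitVec)
open Literature.MathematicalPhysics.QuantumFieldTheory.Balaban1983to89.B5Prop11Lower (nsq nsq_nonneg star_dotProduct_self)
open Literature.MathematicalPhysics.QuantumFieldTheory.Balaban1983to89.B5Blocks16 (blockOf)
open Literature.MathematicalPhysics.QuantumFieldTheory.Balaban1983to89.B5Action121 (sdiff LapS star_mulVec_dotProduct)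
open Literature.MathematicalPhysics.QuantumFieldTheory.Balaban1983to89.B5G183RateUnitTower (lev lev_neZero)
open Summit.QuantumFields.BalabanUV.T4Continuum
open Summit.QuantumFields.BalabanUV.T4Continuum.SubtypeCompression (Coercive isUnit_det_of_coercive opNorm_inv_le_of_coercive)
open Summit.QuantumFields.BalabanUV.T4Continuum.ScalarBlockPoincare (form_LapS_eq nsq_smul)
open Summit.QuantumFields.BalabanUV.T4Continuum.ScalarAveragedPropagator (re_star_dotProduct_le)
open Summit.QuantumFields.BalabanUV.T4Continuum.ScalarBlockTrialFunction (beta1 beta1_ge)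
open Summit.QuantumFields.BalabanUV.T4Continuum.RegionGaugeProjection (gramK)
open Summit.QuantumFields.BalabanUV.T4Continuum.RegionGaugeSlice (form_gram)
open Summit.QuantumFields.BalabanUV.T4Continuum.RegionScalarCompression (variational_abs)
open Summit.QuantumFields.BalabanUV.T4Continuum.GradedSubBlocks (Anchor Anc InSub site meanS s_pos inSub_site meanS_mulVec)
open Summit.QuantumFields.BalabanUV.T4Continuum.GradedSubBlocksRefine (anchorOf inSub_anchorOf blockOf_eq_of_inSub)
open Summit.QuantumFields.BalabanUV.T4Continuum.GradedSubBlockTents (tentS tentS_apply meanS_tentS nsq_sdiff_tentS_le)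
open Summit.QuantumFields.BalabanUV.T4Continuum.GradedWellData
open Summit.QuantumFields.BalabanUV.T4Continuum.GradedWellSlice (QsGWn QsGWn_mul_conjTranspose sGW_dvd_lev)

variable {d : ℕ} (L : ℕ) [NeZero L] (M : Fin d → ℕ) [hM : ∀ μ, NeZero (M μ)] (k m : ℕ) (layer : Tor M → ℕ) (a' : ℝ)

/-! ## §1 Constants -/

/-- `β₁(s) = (s+1)(s+2)/(6s²) ≤ 1` for `s ≥ 1`. [folklore] -/
theorem beta1_le_one (s : ℕ) [NeZero s] : beta1 s ≤ 1 := by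
  have hs : (1 : ℝ) ≤ s := by exact_mod_cast Nat.one_le_iff_ne_zero.mpr (NeZero.ne s)
  unfold beta1
  rw [div_le_one (by positivity)]
  nlinarith

omit hM in
/-- **`n ≤ L^m·s_i` for every layer index `i ≤ m`** (`n/s_i = L^i` when `i ≤ k`; `s_i = 1`, `n = L^k ≤ L^m` when `k < i ≤ m`). [folklore] -/
theorem lev_le_pow_mul_sGW (i : Fin (m + 1)) : ((lev L k : ℕ) : ℝ) ≤ (L : ℝ) ^ m * ((sGW L k i : ℕ) : ℝ) := by
  have hL : 1 ≤ L := Nat.one_le_iff_ne_zero.mpr (NeZero.ne L)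
  have hi : (i : ℕ) ≤ m := Nat.le_of_lt_succ i.isLt
  have h1 : lev L k ≤ L ^ m * sGW L k i := by
    show lev L k ≤ L ^ m * lev L (k - i)
    rw [lev_eq_pow, lev_eq_pow, ← pow_add]
    exact Nat.pow_le_pow_right hL (by omega)
  exact_mod_cast h1

/-- **THE LEVEL-FREE CONSTANT** `σ_GW = 6^{−2d} / ((4d(m+1) + a′)·L^{2m})`. [folklore] -/
def sigGW (d L m : ℕ) (a' : ℝ) : ℝ := ((1 / 6 : ℝ) ^ d) ^ 2 / ((4 * d * (m + 1) + a') * (L : ℝ) ^ (2 * m))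

omit hM in
/-- `0 < σ_GW` for `a′ > 0`. [folklore] -/
theorem sigGW_pos (ha' : 0 < a') : 0 < sigGW d L m a' := by
  have hL : (0 : ℝ) < L := by exact_mod_cast Nat.pos_of_ne_zero (NeZero.ne L)
  unfold sigGW
  positivity

/-! ## §2 The graded trial field -/

/-- the amplitudes of layer `i`: `c_p·s_i^{−d/2}` on the anchors of the rows `p = (i, z)`, zero on anchors that are not rows. [folklore] -/
def coefG (c : RowS L M k m layer → ℂ) (i : Fin (m + 1)) : Anc (fine (lev L k) M) (sGW L k i) → ℂ :=
  fun z => if h : layer (blockOf (lev L k) M z.1) = (i : ℕ) then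
    c ⟨⟨i, z⟩, h⟩ * (((Real.sqrt ((((sGW L k i : ℕ) : ℝ)) ^ d))⁻¹ : ℝ) : ℂ) else 0

/-- **THE GRADED TRIAL FIELD** `ψ_c = Σ_{i ≤ m} tentS s_i (coefG c i)`: one smooth tent per scalar row.
[cite: Balaban1985BackgroundPropagators, (3.48) p.398 (shape: the trial functions behind «Q′G′Q′* ≥ σ₀»)] [folklore] -/
def psiG (c : RowS L M k m layer → ℂ) : TorK L M k → ℂ :=
  ∑ i : Fin (m + 1), tentS (fine (lev L k) M) (sGW L k i) (coefG L M k m layer c i)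

/-- `0 < √(s_i^d)`. [folklore] -/
theorem sqrt_pos (i : ℕ) : 0 < Real.sqrt ((((sGW L k i : ℕ) : ℝ)) ^ d) :=
  Real.sqrt_pos.mpr (pow_pos (by exact_mod_cast s_pos (sGW L k i)) d)

/-- a tent of layer `i` has zero mean on the sub-block of a row of a DIFFERENT layer (disjoint unit blocks). [folklore] -/
theorem meanS_tent_other (c : RowS L M k m layer → ℂ) (p : RowS L M k m layer) {i : Fin (m + 1)} (hi : i ≠ p.1.1) :
    (meanS (fine (lev L k) M) (sGW L k p.1.1) *ᵥ tentS (fine (lev L k) M) (sGW L k i) (coefG L M k m layer c i)) p.1.2 = 0 := by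
  rw [meanS_mulVec _ _ (sGW_dvd L M k p.1.1) p.1.2]
  refine mul_eq_zero_of_right _ (Finset.sum_eq_zero fun j _ => ?_)
  rw [tentS_apply]
  refine mul_eq_zero_of_left ?_ _
  unfold coefG
  rw [dif_neg]
  refine fun h => hi ?_
  have hb1 := blockOf_eq_of_inSub (lev L k) M (sGW L k i) (sGW_dvd_lev L k i)
    (inSub_anchorOf (fine (lev L k) M) (sGW L k i) (site (fine (lev L k) M) (sGW L k p.1.1) p.1.2.1 j))
  have hb2 := blockOf_eq_of_inSub (lev L k) M (sGW L k p.1.1) (sGW_dvd_lev L k p.1.1)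
    (inSub_site (fine (lev L k) M) (sGW L k p.1.1) (sGW_dvd L M k p.1.1) p.1.2.2 j)
  apply Fin.ext
  have hp := p.2
  rw [← hb2, hb1, h] at hp
  exact_mod_cast hp

/-- the own-scale mean of the trial field at a row: `(meanS_{s_p} ψ_c)(z_p) = β₁(s_p)^d·c_p·s_p^{−d/2}`. [folklore] -/
theorem meanS_psiG (c : RowS L M k m layer → ℂ) (p : RowS L M k m layer) :
    (meanS (fine (lev L k) M) (sGW L k p.1.1) *ᵥ psiG L M k m layer c) p.1.2
      = (((beta1 (sGW L k p.1.1)) ^ d : ℝ) : ℂ) *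
        (c p * (((Real.sqrt ((((sGW L k p.1.1 : ℕ) : ℝ)) ^ d))⁻¹ : ℝ) : ℂ)) := by
  unfold psiG
  rw [Matrix.mulVec_sum, Finset.sum_apply, Finset.sum_eq_single p.1.1 (fun i _ hi => meanS_tent_other L M k m layer c p hi)
    (fun h => absurd (Finset.mem_univ _) h), meanS_tentS _ _ (sGW_dvd L M k p.1.1), Pi.smul_apply, smul_eq_mul]
  congr 1
  unfold coefG
  rw [dif_pos p.2]

/-- `(Q′ₙ f)_p = √(s_p^d)·(meanS_{s_p} f)(z_p)`. [folklore] -/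
theorem QsGWn_mulVec_apply (f : TorK L M k → ℂ) (p : RowS L M k m layer) :
    (QsGWn L M k m layer *ᵥ f) p = ((Real.sqrt ((((sGW L k p.1.1 : ℕ) : ℝ)) ^ d) : ℝ) : ℂ) *
      (meanS (fine (lev L k) M) (sGW L k p.1.1) *ᵥ f) p.1.2 := by
  simp only [Matrix.mulVec, dotProduct, QsGWn, QsGW, mul_assoc, ← Finset.mul_sum]

/-- `(Q′_w f)_p = w_p·(meanS_{s_p} f)(z_p)`. [folklore] -/
theorem QsGWw_mulVec_apply (f : TorK L M k → ℂ) (p : RowS L M k m layer) :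
    (QsGWw L M k m layer *ᵥ f) p = ((wGW L k d p.1.1 : ℝ) : ℂ) * (meanS (fine (lev L k) M) (sGW L k p.1.1) *ᵥ f) p.1.2 := by
  simp only [Matrix.mulVec, dotProduct, QsGWw, QsGW, mul_assoc, ← Finset.mul_sum]

/-- **`Q′ₙ ψ_c = (β₁(s_p)^d·c_p)_p`**. [folklore] -/
theorem QsGWn_psiG (c : RowS L M k m layer → ℂ) :
    QsGWn L M k m layer *ᵥ psiG L M k m layer c = fun p => (((beta1 (sGW L k p.1.1)) ^ d : ℝ) : ℂ) * c p := by
  funext p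
  rw [QsGWn_mulVec_apply, meanS_psiG]
  have h := (sqrt_pos L k (d := d) p.1.1).ne'
  have h' : ((Real.sqrt ((((sGW L k p.1.1 : ℕ) : ℝ)) ^ d) : ℝ) : ℂ) ≠ 0 := by exact_mod_cast h
  push_cast
  field_simp

/-- **`Q′_w ψ_c = (L^{i_p}·β₁(s_p)^d·c_p)_p`** (`w_p = L^{i_p}√(s_p^d)`). [folklore] -/
theorem QsGWw_psiG (c : RowS L M k m layer → ℂ) :
    QsGWw L M k m layer *ᵥ psiG L M k m layer c =
      fun p => (((L : ℝ) ^ (p.1.1 : ℕ) * (beta1 (sGW L k p.1.1)) ^ d : ℝ) : ℂ) * c p := by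
  funext p
  rw [QsGWw_mulVec_apply, meanS_psiG]
  have h := (sqrt_pos L k (d := d) p.1.1).ne'
  have h' : ((Real.sqrt ((((sGW L k p.1.1 : ℕ) : ℝ)) ^ d) : ℝ) : ℂ) ≠ 0 := by exact_mod_cast h
  unfold wGW
  push_cast
  field_simp

/-- regrouping a sum over scalar rows by layer and anchor. [folklore] -/
theorem sum_rowS (F : RowS L M k m layer → ℝ) :
    ∑ p, F p = ∑ i : Fin (m + 1), ∑ z : Anc (fine (lev L k) M) (sGW L k i),
      if h : layer (blockOf (lev L k) M z.1) = (i : ℕ) then F ⟨⟨i, z⟩, h⟩ else 0 := by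
  let P : ((i : Fin (m + 1)) × Anc (fine (lev L k) M) (sGW L k i)) → Prop := fun q => layer (blockOf (lev L k) M q.2.1) = (q.1 : ℕ)
  have h1 : (∑ i : Fin (m + 1), ∑ z : Anc (fine (lev L k) M) (sGW L k i),
      if h : layer (blockOf (lev L k) M z.1) = (i : ℕ) then F ⟨⟨i, z⟩, h⟩ else 0) = ∑ q, if h : P q then F ⟨q, h⟩ else 0 := by
    rw [Fintype.sum_sigma]
  have h2 : (∑ q, if h : P q then F ⟨q, h⟩ else 0) = ∑ q ∈ univ.filter P, if h : P q then F ⟨q, h⟩ else 0 :=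
    (Finset.sum_subset (Finset.filter_subset _ _) fun q _ hq => by
      rw [dif_neg]
      exact fun h => hq (Finset.mem_filter.mpr ⟨Finset.mem_univ _, h⟩)).symm
  rw [h1, h2, Finset.sum_subtype (p := P) _ (fun q => by rw [Finset.mem_filter]; simp)]
  exact Finset.sum_congr rfl fun p _ => by rw [dif_pos p.2]

/-- the mass of the layer-`i` amplitudes: `nsq (coefG c i) = s_i^{−d}·Σ_{rows of layer i}‖c_p‖²`. [folklore] -/
theorem nsq_coefG (c : RowS L M k m layer → ℂ) (i : Fin (m + 1)) :
    nsq (coefG L M k m layer c i) = ((((sGW L k i : ℕ) : ℝ)) ^ d)⁻¹ *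
      ∑ z : Anc (fine (lev L k) M) (sGW L k i),
        if h : layer (blockOf (lev L k) M z.1) = (i : ℕ) then ‖c ⟨⟨i, z⟩, h⟩‖ ^ 2 else 0 := by
  unfold nsq coefG
  rw [Finset.mul_sum]
  refine Finset.sum_congr rfl fun z _ => ?_
  have hsd : (0 : ℝ) < (((sGW L k i : ℕ) : ℝ)) ^ d := pow_pos (by exact_mod_cast s_pos (sGW L k i)) d
  split_ifs with h
  · rw [norm_mul, mul_pow, Complex.norm_real, Real.norm_eq_abs, abs_of_nonneg (inv_nonneg.mpr (Real.sqrt_nonneg _)),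
      inv_pow, Real.sq_sqrt hsd.le, mul_comm]
  · simp

/-- `nsq` of a finite sum: `‖Σ_i v_i‖² ≤ #ι·Σ_i‖v_i‖²`. [folklore] -/
theorem nsq_sum_le {ι X : Type*} [Fintype ι] [Fintype X] (v : ι → X → ℂ) :
    nsq (∑ i, v i) ≤ Fintype.card ι * ∑ i, nsq (v i) := by
  unfold nsq
  rw [Finset.mul_sum]
  simp_rw [Finset.mul_sum]
  rw [Finset.sum_comm]
  refine Finset.sum_le_sum fun y _ => ?_
  rw [Finset.sum_apply, ← Finset.mul_sum]
  calc ‖∑ i, v i y‖ ^ 2 ≤ (∑ i, ‖v i y‖) ^ 2 := pow_le_pow_left₀ (norm_nonneg _) (norm_sum_le _ _) 2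
    _ ≤ #(univ : Finset ι) * ∑ i, ‖v i y‖ ^ 2 := sq_sum_le_card_mul_sum_sq
    _ = Fintype.card ι * ∑ i, ‖v i y‖ ^ 2 := by rw [Finset.card_univ]

/-- **the energy of the trial field**: `Σ_ν‖∂_ν ψ_c‖² ≤ 4d(m+1)·L^{2m}·‖c‖²` (`(n/s_i)² ≤ L^{2m}`). [folklore] -/
theorem energy_psiG_le (c : RowS L M k m layer → ℂ) :
    ∑ ν, nsq (sdiff (fine (lev L k) M) ((lev L k : ℕ) : ℂ) ν *ᵥ psiG L M k m layer c)
      ≤ 4 * d * (m + 1) * (L : ℝ) ^ (2 * m) * nsq c := by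
  have hL : (0 : ℝ) < L := by exact_mod_cast Nat.pos_of_ne_zero (NeZero.ne L)
  have hlay : ∀ ν, ∀ i : Fin (m + 1),
      nsq (sdiff (fine (lev L k) M) ((lev L k : ℕ) : ℂ) ν *ᵥ tentS (fine (lev L k) M) (sGW L k i) (coefG L M k m layer c i))
        ≤ 4 * (L : ℝ) ^ (2 * m) * ∑ z : Anc (fine (lev L k) M) (sGW L k i),
            if h : layer (blockOf (lev L k) M z.1) = (i : ℕ) then ‖c ⟨⟨i, z⟩, h⟩‖ ^ 2 else 0 := by
    intro ν i
    have hs : (0 : ℝ) < ((sGW L k i : ℕ) : ℝ) := by exact_mod_cast s_pos (sGW L k i)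
    have hS : 0 ≤ ∑ z : Anc (fine (lev L k) M) (sGW L k i),
        if h : layer (blockOf (lev L k) M z.1) = (i : ℕ) then ‖c ⟨⟨i, z⟩, h⟩‖ ^ 2 else 0 :=
      Finset.sum_nonneg fun z _ => by split_ifs <;> positivity
    refine (nsq_sdiff_tentS_le _ _ (sGW_dvd L M k i) _ ν _).trans ?_
    rw [nsq_coefG, Complex.norm_natCast]
    have h1 : ((lev L k : ℕ) : ℝ) ^ 2 * (4 * ((sGW L k i : ℕ) : ℝ) ^ d / ((sGW L k i : ℕ) : ℝ) ^ 2) *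
        (((((sGW L k i : ℕ) : ℝ)) ^ d)⁻¹) = 4 * (((lev L k : ℕ) : ℝ) / ((sGW L k i : ℕ) : ℝ)) ^ 2 := by
      field_simp
    rw [← mul_assoc, h1]
    refine mul_le_mul_of_nonneg_right ?_ hS
    have h2 : ((lev L k : ℕ) : ℝ) / ((sGW L k i : ℕ) : ℝ) ≤ (L : ℝ) ^ m := by
      rw [div_le_iff₀ hs]; exact lev_le_pow_mul_sGW L k m i
    have h3 : 0 ≤ ((lev L k : ℕ) : ℝ) / ((sGW L k i : ℕ) : ℝ) := by positivity
    rw [pow_mul']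
    nlinarith [pow_le_pow_left₀ h3 h2 2]
  have hν : ∀ ν, nsq (sdiff (fine (lev L k) M) ((lev L k : ℕ) : ℂ) ν *ᵥ psiG L M k m layer c)
      ≤ (m + 1) * (4 * (L : ℝ) ^ (2 * m) * nsq c) := by
    intro ν
    unfold psiG
    rw [Matrix.mulVec_sum]
    refine (nsq_sum_le _).trans ?_
    rw [Fintype.card_fin, Nat.cast_add, Nat.cast_one]
    refine mul_le_mul_of_nonneg_left ?_ (by positivity)
    refine (Finset.sum_le_sum fun i _ => hlay ν i).trans ?_
    rw [← Finset.mul_sum, ← sum_rowS L M k m layer (fun p => ‖c p‖ ^ 2)]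
    rfl
  calc ∑ ν, nsq (sdiff (fine (lev L k) M) ((lev L k : ℕ) : ℂ) ν *ᵥ psiG L M k m layer c)
      ≤ ∑ _ν : Fin d, (m + 1) * (4 * (L : ℝ) ^ (2 * m) * nsq c) := Finset.sum_le_sum fun ν _ => hν ν
    _ = 4 * d * (m + 1) * (L : ℝ) ^ (2 * m) * nsq c := by
        rw [Finset.sum_const, Finset.card_univ, Fintype.card_fin, nsmul_eq_mul]; ring

/-- **the graded mass of the trial field**: `‖Q′_w ψ_c‖² ≤ L^{2m}·‖c‖²`. [folklore] -/
theorem nsq_QsGWw_psiG_le (c : RowS L M k m layer → ℂ) :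
    nsq (QsGWw L M k m layer *ᵥ psiG L M k m layer c) ≤ (L : ℝ) ^ (2 * m) * nsq c := by
  have hL : (1 : ℝ) ≤ L := by exact_mod_cast Nat.one_le_iff_ne_zero.mpr (NeZero.ne L)
  rw [QsGWw_psiG]
  unfold nsq
  rw [Finset.mul_sum]
  refine Finset.sum_le_sum fun p _ => ?_
  rw [norm_mul, mul_pow, Complex.norm_real, Real.norm_eq_abs, sq_abs]
  refine mul_le_mul_of_nonneg_right ?_ (sq_nonneg _)
  have hb0 := (beta1_ge (sGW L k p.1.1)).2.le
  have hb1 := beta1_le_one (sGW L k p.1.1)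
  have hi : (p.1.1 : ℕ) ≤ m := Nat.le_of_lt_succ p.1.1.isLt
  calc ((L : ℝ) ^ (p.1.1 : ℕ) * beta1 (sGW L k p.1.1) ^ d) ^ 2
      ≤ ((L : ℝ) ^ m * 1) ^ 2 := by
        refine pow_le_pow_left₀ (by positivity) ?_ 2
        exact mul_le_mul (pow_le_pow_right₀ hL hi) (pow_le_one₀ hb0 hb1) (by positivity) (by positivity)
    _ = (L : ℝ) ^ (2 * m) := by rw [mul_one, ← pow_mul, mul_comm]

/-- the quadratic form of `Δ′_GW`: `Re⟨f, Δ′_GW f⟩ = Σ_ν‖∂_ν f‖² + a′‖Q′_w f‖²`. [folklore] -/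
theorem re_form_DpGW (f : TorK L M k → ℂ) :
    (star f ⬝ᵥ (DpGW L M k m layer a' *ᵥ f)).re
      = ∑ ν, nsq (sdiff (fine (lev L k) M) ((lev L k : ℕ) : ℂ) ν *ᵥ f) + a' * nsq (QsGWw L M k m layer *ᵥ f) := by
  unfold DpGW
  rw [Matrix.add_mulVec, dotProduct_add, Matrix.smul_mulVec, dotProduct_smul, form_LapS_eq, form_gram,
    Complex.add_re, Complex.ofReal_re, smul_eq_mul, ← Complex.ofReal_mul, Complex.ofReal_re]

/-- `Re⟨ψ_c, Δ′_GW ψ_c⟩ ≤ (4d(m+1) + a′)·L^{2m}·‖c‖²`. [folklore] -/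
theorem re_form_DpGW_psiG_le (ha' : 0 ≤ a') (c : RowS L M k m layer → ℂ) :
    (star (psiG L M k m layer c) ⬝ᵥ (DpGW L M k m layer a' *ᵥ psiG L M k m layer c)).re
      ≤ (4 * d * (m + 1) + a') * (L : ℝ) ^ (2 * m) * nsq c := by
  rw [re_form_DpGW]
  have h1 := energy_psiG_le L M k m layer c
  have h2 := mul_le_mul_of_nonneg_left (nsq_QsGWw_psiG_le L M k m layer c) ha'
  nlinarith

/-! ## §3 The variational bound, `K ≥ S²`, coercivity of the Gram matrix -/

/-- `Re⟨ψ_c, Q′ₙᴴ c⟩ = Σ_p β₁(s_p)^d‖c_p‖² ≥ 6^{−d}‖c‖²`. [folklore] -/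
theorem re_pair_psiG_ge (c : RowS L M k m layer → ℂ) :
    (1 / 6 : ℝ) ^ d * nsq c ≤ (star (psiG L M k m layer c) ⬝ᵥ ((QsGWn L M k m layer)ᴴ *ᵥ c)).re := by
  rw [← star_mulVec_dotProduct, QsGWn_psiG]
  unfold nsq
  simp only [dotProduct, Pi.star_apply, star_mul, Complex.star_def, Complex.conj_ofReal, Complex.re_sum]
  rw [Finset.mul_sum]
  refine Finset.sum_le_sum fun p _ => ?_
  rw [mul_right_comm, Complex.conj_mul', ← Complex.ofReal_pow, ← Complex.ofReal_mul, Complex.ofReal_re, mul_comm (‖c p‖ ^ 2)]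
  exact mul_le_mul_of_nonneg_right (pow_le_pow_left₀ (by norm_num) (beta1_ge (sGW L k p.1.1)).1 d) (sq_nonneg _)

/-- **THE VARIATIONAL LOWER BOUND** `σ_GW·‖c‖² ≤ Re⟨c, Q′ₙ·G′_GW·Q′ₙᴴ c⟩` — (3.48) for the graded means, LEVEL-FREE.
[cite: Balaban1985BackgroundPropagators, (3.48) p.398 (shape: «Q′G′Q′* ≥ σ₀»)] [folklore] -/
theorem form_SGW_ge (hD : IsUnit (DpGW L M k m layer a').det) (ha' : 0 < a') (c : RowS L M k m layer → ℂ) :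
    sigGW d L m a' * nsq c ≤ (star c ⬝ᵥ (QsGWn L M k m layer *ᵥ (GOmGW L M k m layer a' *ᵥ
      ((QsGWn L M k m layer)ᴴ *ᵥ c)))).re := by
  have hL : (0 : ℝ) < L := by exact_mod_cast Nat.pos_of_ne_zero (NeZero.ne L)
  set E : ℝ := (4 * d * (m + 1) + a') * (L : ℝ) ^ (2 * m) with hE
  set β : ℝ := (1 / 6 : ℝ) ^ d with hβ
  set t : ℝ := β / E with ht
  have hpos : ∀ x : TorK L M k → ℂ, 0 ≤ (star x ⬝ᵥ (DpGW L M k m layer a' *ᵥ x)).re := fun x => by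
    rw [re_form_DpGW]; exact add_nonneg (Finset.sum_nonneg fun ν _ => nsq_nonneg _) (mul_nonneg ha'.le (nsq_nonneg _))
  have hDG : DpGW L M k m layer a' * GOmGW L M k m layer a' = 1 := Matrix.mul_nonsing_inv _ hD
  have hv := variational_abs (DpGW_isHermitian L M k m layer a') hpos hDG ((t : ℂ) • psiG L M k m layer c)
    ((QsGWn L M k m layer)ᴴ *ᵥ c)
  rw [star_mulVec_dotProduct, Matrix.conjTranspose_conjTranspose] at hv
  refine le_trans ?_ hv
  have e1 : (star ((t : ℂ) • psiG L M k m layer c) ⬝ᵥ ((QsGWn L M k m layer)ᴴ *ᵥ c)).re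
      = t * (star (psiG L M k m layer c) ⬝ᵥ ((QsGWn L M k m layer)ᴴ *ᵥ c)).re := by
    rw [star_smul, Complex.star_def, Complex.conj_ofReal, smul_dotProduct, smul_eq_mul, Complex.re_ofReal_mul]
  have e2 : (star ((t : ℂ) • psiG L M k m layer c) ⬝ᵥ (DpGW L M k m layer a' *ᵥ ((t : ℂ) • psiG L M k m layer c))).re
      = t ^ 2 * (star (psiG L M k m layer c) ⬝ᵥ (DpGW L M k m layer a' *ᵥ psiG L M k m layer c)).re := by
    rw [star_smul, Complex.star_def, Complex.conj_ofReal, Matrix.mulVec_smul, smul_dotProduct, dotProduct_smul, smul_smul,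
      smul_eq_mul, ← Complex.ofReal_mul, Complex.re_ofReal_mul, sq]
  rw [e1, e2]
  have h1 := re_pair_psiG_ge L M k m layer c
  have h2 := re_form_DpGW_psiG_le L M k m layer a' ha'.le c
  have ht0 : 0 ≤ t := by positivity
  have h3 : sigGW d L m a' = 2 * t * β - t ^ 2 * E := by rw [ht, sigGW, ← hE, ← hβ]; field_simp; ring
  rw [h3]
  rw [← hE] at h2
  nlinarith [mul_le_mul_of_nonneg_left h1 ht0, mul_le_mul_of_nonneg_left h2 (sq_nonneg t), nsq_nonneg c]

/-- orthonormal rows contract: `Q·Qᴴ = 1 ⟹ nsq (Q u) ≤ nsq u` (`1 − QᴴQ` is an orthogonal projection). [folklore] -/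
theorem nsq_mulVec_le_of_mul_conjTranspose_eq_one {u' v' : Type*} [Fintype u'] [Fintype v'] [DecidableEq u'] [DecidableEq v']
    (Q : Matrix u' v' ℂ) (hQ : Q * Qᴴ = 1) (x : v' → ℂ) : nsq (Q *ᵥ x) ≤ nsq x := by
  set P : Matrix v' v' ℂ := 1 - Qᴴ * Q with hP
  have hA : Qᴴ * Q * (Qᴴ * Q) = Qᴴ * Q := by
    rw [Matrix.mul_assoc, ← Matrix.mul_assoc Q, hQ, Matrix.one_mul]
  have hPh : Pᴴ = P := by
    rw [hP, Matrix.conjTranspose_sub, Matrix.conjTranspose_one, Matrix.conjTranspose_mul, Matrix.conjTranspose_conjTranspose]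
  have hPP : Pᴴ * P = P := by
    rw [hPh, hP, Matrix.sub_mul, Matrix.one_mul, Matrix.mul_sub, Matrix.mul_one, hA, sub_self, sub_zero]
  have h1 : ((nsq x : ℝ) : ℂ) = ((nsq (Q *ᵥ x) : ℝ) : ℂ) + ((nsq (P *ᵥ x) : ℝ) : ℂ) := by
    rw [← star_dotProduct_self, ← form_gram Q x, ← form_gram P x, hPP, hP, Matrix.sub_mulVec, Matrix.one_mulVec,
      dotProduct_sub, add_sub_cancel]
  have h2 : nsq x = nsq (Q *ᵥ x) + nsq (P *ᵥ x) := by exact_mod_cast h1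
  linarith [nsq_nonneg (P *ᵥ x)]

/-- **`K ≥ S²`**: `nsq (Q′ₙG′Q′ₙᴴ c) ≤ Re⟨c, gramK G′ Q′ₙ c⟩` (`⟨c, Q′ₙG′²Q′ₙᴴc⟩ = ‖G′Q′ₙᴴc‖² ≥ ‖Q′ₙG′Q′ₙᴴc‖²`). [folklore] -/
theorem nsq_SGW_le_form_gramK (c : RowS L M k m layer → ℂ) :
    nsq (QsGWn L M k m layer *ᵥ (GOmGW L M k m layer a' *ᵥ ((QsGWn L M k m layer)ᴴ *ᵥ c)))
      ≤ (star c ⬝ᵥ (gramK (GOmGW L M k m layer a') (QsGWn L M k m layer) *ᵥ c)).re := by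
  set u := GOmGW L M k m layer a' *ᵥ ((QsGWn L M k m layer)ᴴ *ᵥ c) with hu
  have hG := GOmGW_isHermitian L M k m layer a'
  have e1 : star c ⬝ᵥ (gramK (GOmGW L M k m layer a') (QsGWn L M k m layer) *ᵥ c) = ((nsq u : ℝ) : ℂ) := by
    rw [gramK, ← Matrix.mulVec_mulVec, ← Matrix.mulVec_mulVec, ← Matrix.mulVec_mulVec, ← hu, ← star_dotProduct_self, hu,
      star_mulVec_dotProduct, hG.eq, star_mulVec_dotProduct, Matrix.conjTranspose_conjTranspose, ← hu]
  rw [e1, Complex.ofReal_re]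
  exact nsq_mulVec_le_of_mul_conjTranspose_eq_one _ (QsGWn_mul_conjTranspose L M k m layer) u

/-- `σ_GW²·‖c‖² ≤ Re⟨c, K c⟩`. [folklore] -/
theorem form_gramK_GW_ge (hD : IsUnit (DpGW L M k m layer a').det) (ha' : 0 < a') (c : RowS L M k m layer → ℂ) :
    (sigGW d L m a') ^ 2 * nsq c ≤ (star c ⬝ᵥ (gramK (GOmGW L M k m layer a') (QsGWn L M k m layer) *ᵥ c)).re := by
  set Sc := QsGWn L M k m layer *ᵥ (GOmGW L M k m layer a' *ᵥ ((QsGWn L M k m layer)ᴴ *ᵥ c)) with hSc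
  refine le_trans ?_ (nsq_SGW_le_form_gramK L M k m layer a' c)
  rw [← hSc]
  have hσ := (sigGW_pos L m a' (d := d) ha').le
  have hx := nsq_nonneg c
  have hy := nsq_nonneg Sc
  have h1 : sigGW d L m a' * nsq c ≤ Real.sqrt (nsq c) * Real.sqrt (nsq Sc) :=
    (form_SGW_ge L M k m layer a' hD ha' c).trans (re_star_dotProduct_le _ _)
  have h2 : (sigGW d L m a' * nsq c) ^ 2 ≤ nsq c * nsq Sc :=
    calc (sigGW d L m a' * nsq c) ^ 2 ≤ (Real.sqrt (nsq c) * Real.sqrt (nsq Sc)) ^ 2 := pow_le_pow_left₀ (by positivity) h1 2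
      _ = nsq c * nsq Sc := by rw [mul_pow, Real.sq_sqrt hx, Real.sq_sqrt hy]
  by_cases hz : nsq c = 0
  · rw [hz, mul_zero]; exact hy
  · have hp : 0 < nsq c := lt_of_le_of_ne hx (Ne.symm hz)
    nlinarith [h2, hp]

/-- **SOCKET (GW-K), part 1: THE GRAM MATRIX OF THE GRADED SCALAR DATA IS `σ_GW²`-COERCIVE** — level-free. [folklore] -/
theorem coercive_gramK_GW (hD : IsUnit (DpGW L M k m layer a').det) (ha' : 0 < a') :
    Coercive (gramK (GOmGW L M k m layer a') (QsGWn L M k m layer)) ((sigGW d L m a') ^ 2) :=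
  fun c => form_gramK_GW_ge L M k m layer a' hD ha' c

/-- **`K` is invertible** (R48's `hK`). [folklore] -/
theorem isUnit_det_gramK_GW (hD : IsUnit (DpGW L M k m layer a').det) (ha' : 0 < a') :
    IsUnit (gramK (GOmGW L M k m layer a') (QsGWn L M k m layer)).det :=
  isUnit_det_of_coercive (pow_pos (sigGW_pos L m a' (d := d) ha') 2) (coercive_gramK_GW L M k m layer a' hD ha')

/-- **`‖K⁻¹‖ ≤ σ_GW⁻²`** — R48's `hki` with `ki = σ_GW⁻²` depending on `d, L, m, a′` only (NOT on the level `k`). [folklore] -/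
theorem opNorm_inv_gramK_GW_le (hD : IsUnit (DpGW L M k m layer a').det) (ha' : 0 < a') :
    ‖(gramK (GOmGW L M k m layer a') (QsGWn L M k m layer))⁻¹‖ ≤ ((sigGW d L m a') ^ 2)⁻¹ :=
  opNorm_inv_le_of_coercive (pow_pos (sigGW_pos L m a' (d := d) ha') 2) (coercive_gramK_GW L M k m layer a' hD ha')

end Summit.QuantumFields.BalabanUV.T4Continuum.GradedWellGram

end
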